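import Summits.ResolutionOfSingularities.ResolutionOfSingularities.Theorems.AbsoluteContactInsep
import Summits.ResolutionOfSingularities.ResolutionOfSingularities.Theses.MaxContactCut
import HarnessLib

/-!
# MaxContactCutAbsContactOff3 — decomp-res node «AbsoluteContactInsep» (lens-6 g18, critic row 139), tree file
10/10: the BY-NAME
wiring to the MaxContactCut asides

Content: the node's kernel theorem `AbsoluteContactClasses.absContactOff3 : AbsContactOff3` (file
`AbsoluteContactInsep`, VERBATIM
from the lens-6 g18 pin 3771488b; unconditional, every field of characteristic `p ≠ 3`, inseparable residue fields
included) typed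
against the route decls: it PROVES the aside 27752 `MaxContactCut.AGAbsContactOff3` outright (`agAbsContactOff3`; the route decl
unfolds to `AbsoluteContactClasses.AbsContactOff3` by `rfl`), and with it the g15–g17 cuts of the lens-6 chain become
hypothesis-free BY NAME: aside 27751 `AGAllHug3Off3` ⟺ aside 27753 `AGHypHug3Insep` ⟺ aside 27896 `AGHypHug3InsepNoCurve`
(`agAllHug3Off3_iff_agHypHug3Insep`, `agAllHug3Off3_iff_agHypHug3InsepNoCurve`, `agHypHug3Insep_iff_agHypHug3InsepNoCurve`), and
27896 alone gives 27751 (`agAllHug3Off3_of_noCurve`).  All proofs are one-line applications of the node's corollaries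
(`allHug3Off3_iff_hypHug3Insep'`, `allHug3Off3_iff_noCurve'`, `closes18`) and the tree's
`RegularCurveCut.hypHug3Insep_iff_noCurve`.

Critic: CRITIC-LEDGER row 139 (CLEARED 2026-08-30T20:11:48Z, DECIDED +1: the new lemma in kernel).  Landed by
decomp-res writer g7;
the ledger close of 27752 (`proved`, by `agAbsContactOff3`) is requested from the operator in HOME/STATUS.md if the
gate does not
match it from this file.  No new aside.

(Sources: Matsumura1987 §26–§30; EGA IV₄ 16.11.2; VillamayorU2008ReesDiff; Giraud1975; CossartPiltant2008;
CossartJannsenSaito2020.)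
-/

noncomputable section

open CategoryTheory AlgebraicGeometry TopologicalSpace
open Literature.AlgebraicGeometry.Resolution
open Summit.ResolutionOfSingularities.ResolutionOfSingularities.Theses
open Summit.ResolutionOfSingularities.ResolutionOfSingularities.Theorems

namespace Summit.ResolutionOfSingularities.ResolutionOfSingularities.Theorems.AbsoluteContactClasses

/-- **Aside 27752 PROVED BY NAME**: `MaxContactCut.AGAbsContactOff3` (≝ `AbsoluteContactClasses.AbsContactOff3`) holds —
the lens-6 g18 kernel theorem `absContactOff3`. [new] -/
theorem agAbsContactOff3 : MaxContactCut.AGAbsContactOff3 := absContactOff3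

/-- Aside 27751 ⟺ aside 27753, hypothesis-free (g16 `allHug3Off3_iff_hypHug3Insep` with its `AbsContactOff3` input
discharged). [new] -/
theorem agAllHug3Off3_iff_agHypHug3Insep : MaxContactCut.AGAllHug3Off3 ↔ MaxContactCut.AGHypHug3Insep :=
  allHug3Off3_iff_hypHug3Insep'

/-- Aside 27751 ⟺ aside 27896 (the located no-curve residual of g17), hypothesis-free. [new] -/
theorem agAllHug3Off3_iff_agHypHug3InsepNoCurve :
    MaxContactCut.AGAllHug3Off3 ↔ MaxContactCut.AGHypHug3InsepNoCurve :=
  allHug3Off3_iff_noCurve'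

/-- Aside 27753 ⟺ aside 27896 (tree `RegularCurveCut.hypHug3Insep_iff_noCurve`, restated on the route decls). [new] -/
theorem agHypHug3Insep_iff_agHypHug3InsepNoCurve :
    MaxContactCut.AGHypHug3Insep ↔ MaxContactCut.AGHypHug3InsepNoCurve :=
  hypHug3Insep_iff_noCurve

/-- Aside 27896 alone gives aside 27751 (`closes18`). [new] -/
theorem agAllHug3Off3_of_noCurve (h : MaxContactCut.AGHypHug3InsepNoCurve) : MaxContactCut.AGAllHug3Off3 :=
  closes18 h

end Summit.ResolutionOfSingularities.ResolutionOfSingularities.Theorems.AbsoluteContactClasses
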